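import Summits.HodgeConjecture.HodgeConjecture.Theorems.NikulinTwinTransportLefschetzOneOneK3SerreTheoremA
import Literature.AlgebraicGeometry.HodgeTheory.SerreTheoremALineBundlesProofs

/-!
# Route NikulinTwinTransport — `LefschetzOneOneK3` proved

Closing file of the route item `LefschetzOneOneK3` (Lefschetz `(1,1)` for the projective K3
surfaces of the route: every rational class of type `(1,1)` in `H²(S(ℂ); ℂ)` lies in
`algebraicClasses S 1`). The tree proves the item from Serre's Théorème A for the sheaf of sections
of a holomorphic line cocycle on a smooth projective surface, sections form
(`lefschetzOneOneK3_of_serre_theoremA_lineCocycle_surface`: analytic Lefschetz `(1,1)` by the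
exponential sequence and the `∂∂̄`-lemma, Čech integrality, Chow's theorem, the meromorphic section
`σ₁/σ₂`, the algebraicity of `c₁(𝒪_X(D)^an)`), and that named fact is now DISCHARGED
(`Literature.AlgebraicGeometry.HodgeTheory.serre_theoremA_lineCocycle_surface_holds`, file
`SerreTheoremALineBundlesProofs`: Bertini pencil, one framed cover of the tower `L ⊗ 𝒪_X(mH)^an`
from nested Leray data, Cartan–Serre finiteness of every `Ȟ^q`, the memberwise local algebra of a
transversal pair, and Serre's six-term dimension count). Hence the unconditional theorem
`lefschetzOneOneK3_proof`.
-/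

-- `Summit.HodgeConjecture.HodgeConjecture.Theorems` is the mandated namespace (single-problem summit:
-- Problem = Summit), which `linter.dupNamespace` flags; the lakefile turns the linter off tree-wide
-- (weak option), restated here so stand-alone elaboration is warning-free too.
set_option linter.dupNamespace false

namespace Summit.HodgeConjecture.HodgeConjecture.Theorems

/-- **`LefschetzOneOneK3`** — Lefschetz's theorem on `(1,1)`-classes for the projective K3 surfaces
of route NikulinTwinTransport (indeed for every smooth projective surface of the item's hypothesis):
every rational class of Hodge type `(1,1)` in `H²(S(ℂ); ℂ)` is algebraic. Unconditional:
`lefschetzOneOneK3_of_serre_theoremA_lineCocycle_surface` fed with the discharged fact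
`serre_theoremA_lineCocycle_surface_holds`. [cite: VoisinHodgeI2002, Thm. 11.30 and Cor. 11.34]
[cite: SerreGAGA1956, n° 16–17] -/
theorem lefschetzOneOneK3_proof :
    Summit.HodgeConjecture.HodgeConjecture.Theses.NikulinTwinTransport.LefschetzOneOneK3 :=
  lefschetzOneOneK3_of_serre_theoremA_lineCocycle_surface
    Literature.AlgebraicGeometry.HodgeTheory.serre_theoremA_lineCocycle_surface_holds

end Summit.HodgeConjecture.HodgeConjecture.Theorems
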